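import Summits.CriticalPhenomena.SAWScalingLimit.Theorems.EdgeOfPositivity.Negative.EdgeOfPositivityLoadBearing
import Summits.CriticalPhenomena.SAWScalingLimit.Theorems.EdgeOfPositivity.Negative.EdgeOfPositivityRectDomain

/-!
# `EdgeOfPositivity` (crux stmt-CriticalPhenomena-11344): the certified window `x ≥ 0.551`

Negative-lane support file (refuter `cdisprove`, landed copy of §2 of
`Cruxes/EdgeOfPositivity/Disproof.lean`): ONE six-site domain — the `2 × 3` box at mesh `1` —
carries an admissible quadruple violating TP₂ strictly at every fugacity `x` with
`x⁴ + 3x² > 1`, in particular every `x ≥ 0.551` (`edgeOfPositivityAt_of_ge`); hence the crux is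
EQUIVALENT to its restriction to the window `x_c < x < 0.551` (`edgeOfPositivity_iff_window`).
Partition functions are bounded above by exhaustion (kernel-evaluated complete DFS) and below by
explicit SAWs.  No Theses statement is asserted (an `↔`-reduction and existential small-model
facts only).
-/

noncomputable section

open MeasureTheory Filter Topology Set Function
open Literature.Probability.LatticeModels Literature.Probability.Percolation
open Literature.Probability.RandomPlanarGeometry Literature.Probability.RandomPlanarGeometry.SAW
open scoped ENNReal NNReal

namespace Summit.CriticalPhenomena.SAWScalingLimit.Theorems.EdgeOfPositivity.Negative

open Summit.CriticalPhenomena.SAWScalingLimit.Theses.SAWTotalPositivity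

/-! ## §2 The certified window: ONE six-site domain settles every `x ≥ 0.551`

The domain is the open rectangle `R = (-1/2, 5/2) × (-1/2, 3/2)` at mesh `δ = 1`, whose discrete
domain is the `2 × 3` grid `{0,1,2} × {0,1}`; the quadruple is `p₁ = (0,0)`, `p₂ = (1,1)`,
`p₃ = (2,1)`, `p₄ = (1,0)` (in the cyclic boundary order `p₁, p₄, p₃, p₂`; the violated
non-crossing pairing is `(p₁p₂ | p₃p₄)`):
`Z(p₁,p₂) = Z(p₃,p₄) = 2x² + x⁴`, `Z(p₁,p₃) = 3x³ + x⁵`, `Z(p₂,p₄) = x + 2x³`, and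
`Z₁₃Z₂₄ − Z₁₂Z₃₄ = x⁴ (x⁴ + 3x² − 1) > 0 ⟺ x > 0.550251…`.
The partition functions are certified by a kernel-evaluated, proved-complete DFS (§2b). -/

/-! ### §2c The `2 × 3` box: neighbour lists, exhaustive path lists, partition functions -/

/-- The `2 × 3` box `R = (-1/2, 5/2) × (-1/2, 3/2)`. [folklore] -/
def R23 : Set ℂ := rectDomain 2 1

/-- The graph `R_1` of the `2 × 3` box. [folklore] -/
abbrev G23 : SimpleGraph (Site 2) := discreteDomainGraph R23 1

/-- The six sites of the box, as a list. [folklore] -/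
def sites23 : List (Site 2) := [st 0 0, st 1 0, st 2 0, st 0 1, st 1 1, st 2 1]

/-- Neighbour lists of the `2 × 3` grid graph. [folklore] -/
def nbr23 (v : Site 2) : List (Site 2) :=
  if v = st 0 0 then [st 1 0, st 0 1]
  else if v = st 1 0 then [st 0 0, st 2 0, st 1 1]
  else if v = st 2 0 then [st 1 0, st 2 1]
  else if v = st 0 1 then [st 0 0, st 1 1]
  else if v = st 1 1 then [st 0 1, st 2 1, st 1 0]
  else if v = st 2 1 then [st 1 1, st 2 0]
  else []

/-- A site of the grid `{0,1,2} × {0,1}` is one of the six listed sites. [folklore] -/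
theorem mem_sites23_of_mem_rectSites {v : Site 2} (hv : v ∈ rectSites 2 1) : v ∈ sites23 := by
  rw [mem_rectSites_iff] at hv
  obtain ⟨⟨h1, h2⟩, h3, h4⟩ := hv
  rw [← st_eta v]
  have h2' : v 0 ≤ 2 := by exact_mod_cast h2
  have h4' : v 1 ≤ 1 := by exact_mod_cast h4
  interval_cases (v 0) <;> interval_cases (v 1) <;> simp [sites23]

/-- The neighbour lists contain the adjacency of `R_1`. [folklore] -/
theorem mem_nbr23_of_adj (a b : Site 2) (h : G23.Adj a b) : b ∈ nbr23 a := by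
  rw [G23, R23, adj_rect_iff] at h
  obtain ⟨hab, ha, hb⟩ := h
  have ha' := mem_sites23_of_mem_rectSites ha
  have hb' := mem_sites23_of_mem_rectSites hb
  simp only [sites23, List.mem_cons, List.mem_nil_iff, or_false] at ha' hb'
  rcases ha' with rfl | rfl | rfl | rfl | rfl | rfl <;>
    rcases hb' with rfl | rfl | rfl | rfl | rfl | rfl <;>
    first | decide | exact absurd hab (by decide)

/-- **Exhaustion.** The support of every SAW of the box between grid sites `u ≠ v`... is one of the
lists produced by the DFS with fuel `5`. [folklore] -/
theorem support_mem_allPaths {u v : Site 2} (hu : u ∈ rectSites 2 1) (γ : DomainSAW R23 1 u v) :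
    γ.walk.support ∈ allPaths nbr23 v 5 u [] := by
  have hsup : γ.walk.support = u :: γ.walk.support.tail := (γ.walk.cons_tail_support).symm
  rw [hsup]
  apply mem_allPaths
  · exact follows_support_tail nbr23 mem_nbr23_of_adj γ.walk
  · rw [← hsup]; exact γ.isPath.support_nodup
  · intro w _; exact List.not_mem_nil
  · have h1 : (u :: γ.walk.support.tail).getLast (List.cons_ne_nil _ _) =
        γ.walk.support.getLast γ.walk.support_ne_nil := by
      congr 1; exact hsup.symm
    rw [h1, SimpleGraph.Walk.getLast_support]
  · -- a repetition-free list of grid sites has at most six elements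
    have hsub : γ.walk.support ⊆ sites23 := fun w hw =>
      mem_sites23_of_mem_rectSites (support_subset_rectSites hu γ.walk w hw)
    have hlen : γ.walk.support.length ≤ sites23.length :=
      (List.subperm_of_subset γ.isPath.support_nodup hsub).length_le
    have : (u :: γ.walk.support.tail).length ≤ 6 := by rw [← hsup]; exact hlen
    rw [List.length_cons] at this
    omega

/-- EXHAUSTIVE LIST (kernel-evaluated DFS): the supports of SAWs `(0,0) → (1,1)`. [folklore] -/
theorem allPaths_00_11 : allPaths nbr23 (st 1 1) 5 (st 0 0) [] =
    [[st 0 0, st 1 0, st 2 0, st 2 1, st 1 1], [st 0 0, st 1 0, st 1 1], [st 0 0, st 0 1, st 1 1]] := by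
  decide

/-- EXHAUSTIVE LIST (kernel-evaluated DFS): the supports of SAWs `(2,1) → (1,0)`. [folklore] -/
theorem allPaths_21_10 : allPaths nbr23 (st 1 0) 5 (st 2 1) [] =
    [[st 2 1, st 1 1, st 0 1, st 0 0, st 1 0], [st 2 1, st 1 1, st 1 0], [st 2 1, st 2 0, st 1 0]] := by
  decide


/-- EXHAUSTIVE LIST (kernel-evaluated DFS): the supports of SAWs `(0,0) → (2,1)`. [folklore] -/
theorem allPaths_00_21 : allPaths nbr23 (st 2 1) 5 (st 0 0) [] =
    [[st 0 0, st 1 0, st 2 0, st 2 1], [st 0 0, st 1 0, st 1 1, st 2 1],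
     [st 0 0, st 0 1, st 1 1, st 2 1], [st 0 0, st 0 1, st 1 1, st 1 0, st 2 0, st 2 1]] := by
  decide

/-! ### §2d Upper bounds: `Z ≤` the weight of an exhaustive support list -/

/-- Two SAWs with the same underlying walk are equal. [folklore] -/
theorem DomainSAW_ext {Ω : Set ℂ} {δ : ℝ} {u v : Site 2} {γ γ' : DomainSAW Ω δ u v}
    (h : γ.walk = γ'.walk) : γ = γ' := by
  cases γ; cases γ'; cases h; rfl

/-- The support map is injective on SAWs. [folklore] -/
theorem support_injective {Ω : Set ℂ} {δ : ℝ} {u v : Site 2} :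
    Injective fun γ : DomainSAW Ω δ u v => γ.walk.support :=
  fun _ _ h => DomainSAW_ext (SimpleGraph.Walk.support_injective h)

/-- The weight `x^{|L| - 1}` of a vertex list (`= x^{|γ|}` on the support of `γ`). [folklore] -/
def listWeight (x : ℝ) (L : List (Site 2)) : ℝ≥0∞ := ENNReal.ofReal (x ^ (L.length - 1))

/-- `x^{|γ|}` is the weight of the support of `γ`. [folklore] -/
theorem listWeight_support (x : ℝ) {Ω : Set ℂ} {δ : ℝ} {u v : Site 2} (γ : DomainSAW Ω δ u v) :
    listWeight x γ.walk.support = ENNReal.ofReal (x ^ γ.length) := by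
  rw [listWeight, SimpleGraph.Walk.length_support]; rfl

/-- **Upper bound by exhaustion.** If every SAW `u → v` has its support in the finite family `S`,
then `Z_x(u,v) ≤ Σ_{L ∈ S} x^{|L|-1}`. [folklore] -/
theorem Zx_le_sum_of_supports (x : ℝ) {Ω : Set ℂ} {δ : ℝ} {u v : Site 2} (S : Finset (List (Site 2)))
    (hS : ∀ γ : DomainSAW Ω δ u v, γ.walk.support ∈ S) :
    Zx x Ω δ u v ≤ ∑ L ∈ S, listWeight x L := by
  let f : DomainSAW Ω δ u v → ↥S := fun γ => ⟨γ.walk.support, hS γ⟩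
  have hf : Injective f := fun a b h => support_injective (congrArg Subtype.val h)
  calc Zx x Ω δ u v = ∑' γ : DomainSAW Ω δ u v, (fun b : ↥S => listWeight x b.1) (f γ) := by
        rw [Zx]; congr 1; funext γ; exact (listWeight_support x γ).symm
    _ ≤ ∑' b : ↥S, listWeight x b.1 := ENNReal.tsum_comp_le_tsum_of_injective hf _
    _ = ∑ L ∈ S, listWeight x L := by rw [tsum_fintype, Finset.sum_coe_sort]

/-- `(0,0)` is a site of the box. [folklore] -/
theorem st00_mem : st 0 0 ∈ rectSites 2 1 := by simp [mem_rectSites_iff]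

/-- `(2,1)` is a site of the box. [folklore] -/
theorem st21_mem : st 2 1 ∈ rectSites 2 1 := by simp [mem_rectSites_iff]

/-- `Z_x((0,0),(1,1)) ≤ 2x² + x⁴` on the `2 × 3` box (every real `x`). [folklore] -/
theorem Z_00_11_le (x : ℝ) :
    Zx x R23 1 (st 0 0) (st 1 1) ≤ ENNReal.ofReal (2 * x ^ 2 + x ^ 4) := by
  have hS : ∀ γ : DomainSAW R23 1 (st 0 0) (st 1 1), γ.walk.support ∈
      ([[st 0 0, st 1 0, st 2 0, st 2 1, st 1 1], [st 0 0, st 1 0, st 1 1], [st 0 0, st 0 1, st 1 1]] :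
        List (List (Site 2))).toFinset := by
    intro γ
    rw [List.mem_toFinset, ← allPaths_00_11]
    exact support_mem_allPaths st00_mem γ
  refine (Zx_le_sum_of_supports x _ hS).trans (le_of_eq ?_)
  rw [List.sum_toFinset _ (by decide)]
  simp only [List.map_cons, List.map_nil, List.sum_cons, List.sum_nil, add_zero, listWeight,
    List.length_cons, List.length_nil]
  norm_num
  rw [← ENNReal.ofReal_add (by positivity) (by positivity), ← ENNReal.ofReal_add (by positivity) (by positivity)]
  congr 1; ring

/-- `Z_x((2,1),(1,0)) ≤ 2x² + x⁴` on the `2 × 3` box (every real `x`). [folklore] -/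
theorem Z_21_10_le (x : ℝ) :
    Zx x R23 1 (st 2 1) (st 1 0) ≤ ENNReal.ofReal (2 * x ^ 2 + x ^ 4) := by
  have hS : ∀ γ : DomainSAW R23 1 (st 2 1) (st 1 0), γ.walk.support ∈
      ([[st 2 1, st 1 1, st 0 1, st 0 0, st 1 0], [st 2 1, st 1 1, st 1 0], [st 2 1, st 2 0, st 1 0]] :
        List (List (Site 2))).toFinset := by
    intro γ
    rw [List.mem_toFinset, ← allPaths_21_10]
    exact support_mem_allPaths st21_mem γ
  refine (Zx_le_sum_of_supports x _ hS).trans (le_of_eq ?_)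
  rw [List.sum_toFinset _ (by decide)]
  simp only [List.map_cons, List.map_nil, List.sum_cons, List.sum_nil, add_zero, listWeight,
    List.length_cons, List.length_nil]
  norm_num
  rw [← ENNReal.ofReal_add (by positivity) (by positivity), ← ENNReal.ofReal_add (by positivity) (by positivity)]
  congr 1; ring

/-! ### §2e Lower bounds: explicit SAWs -/

/-- Adjacency of `R_1` from decidable data. [folklore] -/
theorem adj23 {a b : Site 2} (h : (zdGraph 2).Adj a b ∧ ((0 ≤ a 0 ∧ a 0 ≤ 2) ∧ (0 ≤ a 1 ∧ a 1 ≤ 1)) ∧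
    ((0 ≤ b 0 ∧ b 0 ≤ 2) ∧ (0 ≤ b 1 ∧ b 1 ≤ 1))) : G23.Adj a b :=
  adj_rect_iff.2 ⟨h.1, by simpa [mem_rectSites_iff] using h.2.1, by simpa [mem_rectSites_iff] using h.2.2⟩

/-- A walk whose support has no duplicate is a SAW. [folklore] -/
def mkSAW {u v : Site 2} (w : G23.Walk u v) (h : w.support.Nodup) : DomainSAW R23 1 u v :=
  ⟨w, SimpleGraph.Walk.IsPath.mk' h⟩

/-- The SAW `(0,0) → (1,0) → (2,0) → (2,1)`. [folklore] -/
def sW1 : DomainSAW R23 1 (st 0 0) (st 2 1) :=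
  mkSAW (.cons (v := st 1 0) (adj23 (by decide)) (.cons (v := st 2 0) (adj23 (by decide))
    (.cons (v := st 2 1) (adj23 (by decide)) .nil))) (by decide)
/-- The SAW `(0,0) → (1,0) → (1,1) → (2,1)`. [folklore] -/
def sW2 : DomainSAW R23 1 (st 0 0) (st 2 1) :=
  mkSAW (.cons (v := st 1 0) (adj23 (by decide)) (.cons (v := st 1 1) (adj23 (by decide))
    (.cons (v := st 2 1) (adj23 (by decide)) .nil))) (by decide)
/-- The SAW `(0,0) → (0,1) → (1,1) → (2,1)`. [folklore] -/
def sW3 : DomainSAW R23 1 (st 0 0) (st 2 1) :=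
  mkSAW (.cons (v := st 0 1) (adj23 (by decide)) (.cons (v := st 1 1) (adj23 (by decide))
    (.cons (v := st 2 1) (adj23 (by decide)) .nil))) (by decide)
/-- The SAW `(0,0) → (0,1) → (1,1) → (1,0) → (2,0) → (2,1)`. [folklore] -/
def sW4 : DomainSAW R23 1 (st 0 0) (st 2 1) :=
  mkSAW (.cons (v := st 0 1) (adj23 (by decide)) (.cons (v := st 1 1) (adj23 (by decide))
    (.cons (v := st 1 0) (adj23 (by decide)) (.cons (v := st 2 0) (adj23 (by decide))
      (.cons (v := st 2 1) (adj23 (by decide)) .nil))))) (by decide)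
/-- The SAW `(1,1) → (1,0)`. [folklore] -/
def sV1 : DomainSAW R23 1 (st 1 1) (st 1 0) :=
  mkSAW (.cons (v := st 1 0) (adj23 (by decide)) .nil) (by decide)
/-- The SAW `(1,1) → (0,1) → (0,0) → (1,0)`. [folklore] -/
def sV2 : DomainSAW R23 1 (st 1 1) (st 1 0) :=
  mkSAW (.cons (v := st 0 1) (adj23 (by decide)) (.cons (v := st 0 0) (adj23 (by decide))
    (.cons (v := st 1 0) (adj23 (by decide)) .nil))) (by decide)
/-- The SAW `(1,1) → (2,1) → (2,0) → (1,0)`. [folklore] -/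
def sV3 : DomainSAW R23 1 (st 1 1) (st 1 0) :=
  mkSAW (.cons (v := st 2 1) (adj23 (by decide)) (.cons (v := st 2 0) (adj23 (by decide))
    (.cons (v := st 1 0) (adj23 (by decide)) .nil))) (by decide)
/-- The SAW `(0,0) → (0,1) → (1,1)` (disjoint from `sQ34`). [folklore] -/
def sP12 : DomainSAW R23 1 (st 0 0) (st 1 1) :=
  mkSAW (.cons (v := st 0 1) (adj23 (by decide)) (.cons (v := st 1 1) (adj23 (by decide)) .nil)) (by decide)
/-- The SAW `(2,1) → (2,0) → (1,0)` (disjoint from `sP12`). [folklore] -/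
def sQ34 : DomainSAW R23 1 (st 2 1) (st 1 0) :=
  mkSAW (.cons (v := st 2 0) (adj23 (by decide)) (.cons (v := st 1 0) (adj23 (by decide)) .nil)) (by decide)
/-- The SAW `(0,0) → (1,0)` (disjoint from `sQ23`). [folklore] -/
def sP14 : DomainSAW R23 1 (st 0 0) (st 1 0) :=
  mkSAW (.cons (v := st 1 0) (adj23 (by decide)) .nil) (by decide)
/-- The SAW `(1,1) → (2,1)` (disjoint from `sP14`). [folklore] -/
def sQ23 : DomainSAW R23 1 (st 1 1) (st 2 1) :=
  mkSAW (.cons (v := st 2 1) (adj23 (by decide)) .nil) (by decide)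

/-- Four distinct SAWs `(0,0) → (2,1)`. [folklore] -/
def e13 : Fin 4 → DomainSAW R23 1 (st 0 0) (st 2 1)
  | 0 => sW1 | 1 => sW2 | 2 => sW3 | 3 => sW4

/-- Three distinct SAWs `(1,1) → (1,0)`. [folklore] -/
def e24 : Fin 3 → DomainSAW R23 1 (st 1 1) (st 1 0)
  | 0 => sV1 | 1 => sV2 | 2 => sV3

/-- Supports of the four SAWs `(0,0) → (2,1)`. [folklore] -/
theorem e13_support (i : Fin 4) : (e13 i).walk.support =
    (![[st 0 0, st 1 0, st 2 0, st 2 1], [st 0 0, st 1 0, st 1 1, st 2 1],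
       [st 0 0, st 0 1, st 1 1, st 2 1], [st 0 0, st 0 1, st 1 1, st 1 0, st 2 0, st 2 1]] i) := by
  fin_cases i <;> rfl

/-- Supports of the three SAWs `(1,1) → (1,0)`. [folklore] -/
theorem e24_support (i : Fin 3) : (e24 i).walk.support =
    (![[st 1 1, st 1 0], [st 1 1, st 0 1, st 0 0, st 1 0], [st 1 1, st 2 1, st 2 0, st 1 0]] i) := by
  fin_cases i <;> rfl

/-- The four SAWs `(0,0) → (2,1)` are distinct. [folklore] -/
theorem e13_injective : Injective e13 := by
  intro i j h
  have h' := congrArg (fun γ : DomainSAW R23 1 (st 0 0) (st 2 1) => γ.walk.support) h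
  simp only [e13_support] at h'
  fin_cases i <;> fin_cases j <;> first | rfl | exact absurd h' (by decide)

/-- The three SAWs `(1,1) → (1,0)` are distinct. [folklore] -/
theorem e24_injective : Injective e24 := by
  intro i j h
  have h' := congrArg (fun γ : DomainSAW R23 1 (st 1 1) (st 1 0) => γ.walk.support) h
  simp only [e24_support] at h'
  fin_cases i <;> fin_cases j <;> first | rfl | exact absurd h' (by decide)

/-- `Z_x((0,0),(2,1)) ≥ 3x³ + x⁵` (`0 ≤ x`). [folklore] -/
theorem Z_00_21_ge {x : ℝ} (hx : 0 ≤ x) :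
    ENNReal.ofReal (3 * x ^ 3 + x ^ 5) ≤ Zx x R23 1 (st 0 0) (st 2 1) := by
  have h := ENNReal.tsum_comp_le_tsum_of_injective e13_injective
    (fun γ : DomainSAW R23 1 (st 0 0) (st 2 1) => ENNReal.ofReal (x ^ γ.length))
  rw [tsum_fintype] at h
  refine le_trans (le_of_eq ?_) h
  have hl : ∀ i, (e13 i).length = (e13 i).walk.support.length - 1 := fun i => by
    rw [SimpleGraph.Walk.length_support]; rfl
  simp only [Fin.sum_univ_four, hl, e13_support]
  simp only [Matrix.cons_val_zero, Matrix.cons_val_one, Matrix.cons_val, List.length_cons,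
    List.length_nil]
  norm_num
  rw [← ENNReal.ofReal_add (by positivity) (by positivity), ← ENNReal.ofReal_add (by positivity) (by positivity),
    ← ENNReal.ofReal_add (by positivity) (by positivity)]
  congr 1; ring

/-- `Z_x((1,1),(1,0)) ≥ x + 2x³` (`0 ≤ x`). [folklore] -/
theorem Z_11_10_ge {x : ℝ} (hx : 0 ≤ x) :
    ENNReal.ofReal (x + 2 * x ^ 3) ≤ Zx x R23 1 (st 1 1) (st 1 0) := by
  have h := ENNReal.tsum_comp_le_tsum_of_injective e24_injective
    (fun γ : DomainSAW R23 1 (st 1 1) (st 1 0) => ENNReal.ofReal (x ^ γ.length))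
  rw [tsum_fintype] at h
  refine le_trans (le_of_eq ?_) h
  have hl : ∀ i, (e24 i).length = (e24 i).walk.support.length - 1 := fun i => by
    rw [SimpleGraph.Walk.length_support]; rfl
  simp only [Fin.sum_univ_three, hl, e24_support]
  simp only [Matrix.cons_val_zero, Matrix.cons_val_one, Matrix.cons_val, List.length_cons,
    List.length_nil]
  norm_num
  rw [← ENNReal.ofReal_add (by positivity) (by positivity), ← ENNReal.ofReal_add (by positivity) (by positivity)]
  congr 1; ring

/-! ### §2f Admissibility of the quadruple and the certified window -/

/-- INTERLACING on the `2 × 3` box: every SAW `(0,0) → (2,1)` crosses the middle column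
`{(1,0), (1,1)}`, whose two sites are the endpoints of every SAW `(1,1) → (1,0)`. [folklore] -/
theorem interlace23 (P : DomainSAW R23 1 (st 0 0) (st 2 1)) (Q : DomainSAW R23 1 (st 1 1) (st 1 0)) :
    ∃ v, v ∈ P.walk.support ∧ v ∈ Q.walk.support := by
  have hP := support_mem_allPaths st00_mem P
  rw [allPaths_00_21] at hP
  have hQs : st 1 1 ∈ Q.walk.support := Q.walk.start_mem_support
  have hQe : st 1 0 ∈ Q.walk.support := Q.walk.end_mem_support
  simp only [List.mem_cons, List.mem_nil_iff, or_false] at hP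
  rcases hP with h | h | h | h
  · exact ⟨st 1 0, by rw [h]; decide, hQe⟩
  · exact ⟨st 1 0, by rw [h]; decide, hQe⟩
  · exact ⟨st 1 1, by rw [h]; decide, hQs⟩
  · exact ⟨st 1 1, by rw [h]; decide, hQs⟩

/-- `List.Disjoint` from its decidable bounded-quantifier form. [folklore] -/
theorem disjoint_of_forall {l₁ l₂ : List (Site 2)} (h : ∀ a ∈ l₁, a ∉ l₂) : List.Disjoint l₁ l₂ :=
  fun _ ha hb => h _ ha hb

/-- The algebra of the certificate: `(2x²+x⁴)² < (3x³+x⁵)(x+2x³) ⟺ x⁴(x⁴+3x²−1) > 0`. [folklore] -/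
theorem cert_poly {x : ℝ} (hx : 0 < x) (hpoly : 1 < x ^ 4 + 3 * x ^ 2) :
    (2 * x ^ 2 + x ^ 4) * (2 * x ^ 2 + x ^ 4) < (3 * x ^ 3 + x ^ 5) * (x + 2 * x ^ 3) := by
  have h4 : 0 < x ^ 4 := by positivity
  nlinarith [mul_pos h4 (sub_pos.2 hpoly)]

/-- **THE CERTIFIED WINDOW (polynomial form).** For every fugacity `x > 0` with `x⁴ + 3x² > 1`
(i.e. `x > 0.550251…`) the `2 × 3` box carries an admissible quadruple violating TP₂ strictly:
`EdgeOfPositivityAt x`. In particular the crux holds at every `x ≥ 0.551`, and at every `x ≥ 1`.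
[folklore] -/
theorem edgeOfPositivityAt_of_poly {x : ℝ} (hx : 0 < x) (hpoly : 1 < x ^ 4 + 3 * x ^ 2) :
    EdgeOfPositivityAt x := by
  refine ⟨R23, 1, st 0 0, st 1 1, st 2 1, st 1 0, isBounded_rectDomain 2 1,
    simplyConnectedSpace_rectDomain 2 1, one_pos, interlace23, ⟨sP12, sQ34, ?_⟩, ⟨sP14, sQ23, ?_⟩, ?_⟩
  · exact disjoint_of_forall (by decide)
  · exact disjoint_of_forall (by decide)
  have hA : (0 : ℝ) ≤ 2 * x ^ 2 + x ^ 4 := by positivity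
  have hBC : (0 : ℝ) < (3 * x ^ 3 + x ^ 5) * (x + 2 * x ^ 3) := by positivity
  calc Zx x R23 1 (st 0 0) (st 1 1) * Zx x R23 1 (st 2 1) (st 1 0)
      ≤ ENNReal.ofReal (2 * x ^ 2 + x ^ 4) * ENNReal.ofReal (2 * x ^ 2 + x ^ 4) :=
        mul_le_mul' (Z_00_11_le x) (Z_21_10_le x)
    _ < ENNReal.ofReal (3 * x ^ 3 + x ^ 5) * ENNReal.ofReal (x + 2 * x ^ 3) := by
        rw [← ENNReal.ofReal_mul hA, ← ENNReal.ofReal_mul (by positivity),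
          ENNReal.ofReal_lt_ofReal_iff hBC]
        exact cert_poly hx hpoly
    _ ≤ Zx x R23 1 (st 0 0) (st 2 1) * Zx x R23 1 (st 1 1) (st 1 0) :=
        mul_le_mul' (Z_00_21_ge hx.le) (Z_11_10_ge hx.le)

/-- **THE CERTIFIED WINDOW.** `EdgeOfPositivityAt x` for every `x ≥ 0.551`: ONE six-site domain
settles the crux on `[0.551, ∞)` (numerically the same quadruple works from `0.550252` on).
[folklore] -/
theorem edgeOfPositivityAt_of_ge {x : ℝ} (hx : 0.551 ≤ x) : EdgeOfPositivityAt x := by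
  have hx0 : 0 < x := by linarith
  have h2 : 0.303601 ≤ x ^ 2 := by nlinarith
  have h4 : 0.303601 ^ 2 ≤ x ^ 4 := by nlinarith
  exact edgeOfPositivityAt_of_poly hx0 (by norm_num at h4 ⊢; linarith)

/-- **REDUCTION OF THE CRUX TO A WINDOW.** `EdgeOfPositivity` is equivalent to its restriction to
fugacities `x_c < x < 0.551`: everything at or above `0.551` is certified by the `2 × 3` box.
A disproof must therefore exhibit an `x⋆ ∈ (x_c, 0.551)` at which TP₂ holds in EVERY domain —
and exact enumeration (`exp/exp3_scan.py`, `exp/exp4_strips.py`) finds violating quadruples down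
to `x = 0.4350` (`6 × 14` strip), with thresholds still decreasing in the domain size. [folklore] -/
theorem edgeOfPositivity_iff_window :
    EdgeOfPositivity ↔ ∀ x : ℝ, criticalFugacity < x → x < 0.551 → EdgeOfPositivityAt x := by
  rw [edgeOfPositivity_iff]
  refine ⟨fun h x hx _ => h x hx, fun h x hx => ?_⟩
  by_cases hlt : x < 0.551
  · exact h x hx hlt
  · exact edgeOfPositivityAt_of_ge (not_lt.1 hlt)

end Summit.CriticalPhenomena.SAWScalingLimit.Theorems.EdgeOfPositivity.Negative
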